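import Summits.QuantumFields.YangMills.Theorems.UnitScaleTiltProp7LocMinOfMultiplierRows
import Literature.MathematicalPhysics.QuantumFieldTheory.Balaban1983to89.Node00.DomainsOfSeq
import HarnessLib

/-!
# Route `UnitScaleTilt`, crux K1 child «MinimiserStabilityRegPr» (stmt-QuantumFields-19200) — THE GROWTH-SIDE DOOR WITH THE JOINT ROW MODULO COARSE GAUGE:
# E′ ⇐ CHART_W ∧ HESS_W′ ∧ `∃ μ ∈ 𝔰𝔲(2)^{sites}: Σ_c‖Q^{(K−n)}_W(iD)(c) − (μ(c₋) − W̄(c)μ(c₊)W̄(c)*)‖ ≤ C₁·ℓ⁻¹·Σ‖D‖² + C₂·ℓ·Σ_p‖ℒ_p(D)‖²` — the multiplier current is conserved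

Cell `ym3-torus` ∕ fleet seat `ym-ust-19200-p1` (gen 14, route-R lead ∕ (n3) namer).  THEOREMS ONLY (0 `def`, 0 `sorry`); `--supports stmt-QuantumFields-19200`, count-neutral.
YM₃ on T³ is a ladder rung (R3), not the Clay problem; nothing here claims the stub, the crux, d = 4 or the mass gap; E′ is NOT closed by this file.

WHY («CONSERVED-CURRENT SHORTCUT», this seat 2026-08-28T15:11Z).  The door of record ✓`Prop7LocMinOfMultiplierRows.isMinOn_regFibrePr_of_multiplierRows_at` (gen 13) charges the
first variation along a competitor direction `iD` by `2e·ℓ⁻¹·Σ_c‖(Q^{(K−n)}_W iD)(c)‖` (✓`Prop7FirstVariationExactPairing.abs_lin_le_sum_norm_trueLinIter`, ★routeR-w2 g1), and the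
supplier lane (N3b) then has to control the FULL `ℓ¹` norm of the true linearised `(K−n)`-fold average of `iD` — including its coarse pure-gauge component, which the
two-channel engine (✓`Prop7TrueLinSourcedOscL1`, ✓`Prop7FibreLogRatioOscL1`) reads through comb-mean ∕ oscillation rows whose source oscillations enter undamped.  But that
component is INVISIBLE to the first variation: `Lin_W` kills every infinitesimal gauge direction `Z^λ_b = λ(b₋) − W_bλ(b₊)W_b*` (gauge invariance of the Wilson action,
✓`Prop7LinGaugeInvariance.lin_sub_gaugeDir_eq`, gen 10), and every recursion family `Q` is linear and EXACT on pure gauges (✓`Prop7TrueLinPureGaugeIter.trueLinIter_sub` ∕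
`trueLinIter_pureGauge`, ★w2-20520: `Q k Z^λ (c) = λ(embIter k c₋) − W̄^{(k)}(c)λ(embIter k c₊)W̄^{(k)}(c)*`).  Hence for every `𝔰𝔲(2)`-valued COARSE site field `μ` (extended to the
fine lattice by `λ := μ ∘ iterBlockOf (K−n)`, ✓`Node00.iterBlockOf_embIter_eq`): `|Lin_W(A)| = |Lin_W(A − Z^λ)| ≤ 2eℓ⁻¹·Σ_c‖Q^{(K−n)}A(c) − (μ(c₋) − W̄(c)μ(c₊)W̄(c)*)‖` — the
Lagrange multiplier of the (0.4)-constraint is covariantly CONSERVED at level `K − n` (cf. clause (ii) of ✓`exists_multiplier_functional`).  The JOINT remainder row is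
therefore needed only MODULO COARSE PURE GAUGES, and on the fibre the exact identity ✓`Prop7TrueLinSourcedStructure.sourced_structure` (`D_k = G_k + P_{Ū^{(k)}}Λ_k`) makes the
supplier's object the REDUCED family alone (✓`Prop7TrueLinSourcedDefectL1.sum_norm_sourcedReduced_le`: mass channel, geometric from the top) — no comb-mean ∕ oscillation rows.
The gauge correction must be `𝔰𝔲(2)`-valued because the exact pairing differentiates along the exponential curve `t ↦ e^{tA}W` inside `SU(2)`.

WHAT IS PROVED (ns `…Theorems.Prop7LocMinOfGaugedRows`).
* §1 `sub_gaugeDir_mem_su2` (letter); ★★ `abs_lin_le_sum_norm_trueLinIter_sub_coarseGauge` — the GAUGED exact pairing displayed above, for every R2-critical `W ∈ (6)(e)`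
  (`10¹⁰L⁶e ≤ 1`), every `𝔰𝔲(2)`-valued `A`, every recursion family `Q` at `W`, every `𝔰𝔲(2)`-valued coarse `μ`.
* §2 ★★ `isMinOn_regFibrePr_of_gaugedRows_at` — one member, one datum: rows CHART_W (`‖D(b)‖ ≤ s`, `A(W′) = A(e^{iD}W)`), HESS_W′ (`κM ≤ K`) and the JOINT row MOD COARSE GAUGE
  (`∃ μ`, `𝔰𝔲(2)`-valued, `Σ_c‖Q (K−n) (iD) c − (μ c₋ − W̄ c·μ c₊·(W̄ c)*)‖ ≤ C₁ℓ⁻¹M + C₂ℓK`) for every competitor, windows as in the door of record ⇒ `W` minimises over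
  (6)(e) ∩ 𝔅_k(V) (✓`Prop7LocMinOfJointRow.isMinOn_regFibrePr_of_linRows_at` ∘ `linRow_of_QRows` with `R :=` the gauged sum).
* §3 ★★★ `stub_PV3E_of_gaugedRows` — the E′ TEXT OF RECORD (verbatim as in ✓`stub_PV3E_of_multiplierRows`, `e₅ := e₆`, `a₁'' := 1`) from ONE displayed uniform hypothesis with
  `L`-only constants `e₆, s₀, C₁, C₂, κ₀`, JOINT row mod coarse gauge.
HONEST SCOPE.  Bookkeeping over landed letters; the located content is the USE of gauge invariance at the door.  DISPLAYED, not proved: CHART_W ([Balaban1985RegularSpaces] Thm 2 at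
the critical background), HESS_W′ ((116) ∕ [Balaban1985BackgroundPropagators] Thm 3.11–3.12), and the JOINT remainder row mod coarse gauge (the `ℓ¹` mass of the REDUCED sourced
family of the log-ratio tower on the fibre in `(mass, curl)` currency — [Balaban1985Variational] (47)–(48), (80); supplier files named on the bus 15:11Z: reality of the true
linearisation, fibre reading mod gauge, one-step log-remainder in mass currency, level sum of the level masses).

References: T. Bałaban, CMP 102 (1985) 277–309 [Balaban1985Variational] ((2), (4)–(7) p.278, (14) p.280, (47)–(48) pp.285–286, (80) p.290, (116) p.295, (141)–(143), Prop. 7 p.299);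
CMP 99 (1985) 389–434 [Balaban1985BackgroundPropagators] ((3.9)–(3.11) p.392, Thm 3.11 p.416); CMP 99 (1985) 75–102 [Balaban1985RegularSpaces] (Thm 2 p.83);
CMP 98 (1985) 17–51 [Balaban1985Averaging] ((11) p.19, (122)–(125) p.36); CMP 109 (1987) 249–301 [Balaban1987RG1] ((0.1)–(0.4) pp.251–253).
-/

set_option autoImplicit false
noncomputable section

open scoped BigOperators Matrix.Norms.L2Operator Matrix Topology
open Filter

namespace Summit.QuantumFields.YangMills.Theorems.Prop7LocMinOfGaugedRows

open Literature.MathematicalPhysics.QuantumFieldTheory.Balaban1983to89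
open Literature.MathematicalPhysics.QuantumFieldTheory.Balaban1983to89.T3ContinuumYM3Torus
open Literature.MathematicalPhysics.QuantumFieldTheory.Balaban1983to89.T3UnitLawDensityEML (ℰp)
open Literature.MathematicalPhysics.QuantumFieldTheory.Balaban1983to89.T3ConstrainedMinimiser
open Literature.MathematicalPhysics.QuantumFieldTheory.Balaban1983to89.T3Thm1Carrier
open Literature.MathematicalPhysics.QuantumFieldTheory.Balaban1983to89.T3PrintedRegularMinimiser
open Literature.MathematicalPhysics.QuantumFieldTheory.Balaban1983to89.T3RegularMinimiser
open Literature.MathematicalPhysics.QuantumFieldTheory.Balaban1983to89.T3Thm1CarrierNative (IsCritR2)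
open Literature.MathematicalPhysics.QuantumFieldTheory.Balaban1983to89.T3SectALandauChart (emb15 CloseAvg pos_of_regPr)
open T4Continuum BlockAveraging AveragingRT ExpMeanLog BlockAveragingEMLLinearised BlockAveragingEMLLinearisedBackground BlockAveragingEMLProp2
open Summit.QuantumFields.YangMills.Theorems.Prop7TPrint (expHermField)
open Summit.QuantumFields.YangMills.Theorems.Prop7LocMinOfJointRow (isMinOn_regFibrePr_of_linRows_at linRow_of_QRows)
open Summit.QuantumFields.YangMills.Theorems.Prop7FirstVariationExactPairing (abs_lin_le_sum_norm_trueLinIter tower_loop_rows_of_regPr gaugeDir_mem_su2)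
open Summit.QuantumFields.YangMills.Theorems.Prop7CurvedLandauRowA (exists_trueLinIter_family)
open Summit.QuantumFields.YangMills.Theorems.Prop7LocMinOfMultiplierRows (I_smul_mem_skewAdjoint trace_I_smul_eq_zero scaled_smallness_mult)
open Summit.QuantumFields.YangMills.Theorems.Prop7TrueLinPureGaugeIter (trueLinIter_sub trueLinIter_pureGauge)
open Summit.QuantumFields.YangMills.Theorems.Prop7LinGaugeInvariance (lin_sub_gaugeDir_eq)
open B15DeterminingSets (embIter)
open B5Eq118OneStroke (iterBlockOf)
open Node00 (iterBlockOf_embIter_eq)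

/-! ## §1 The gauged exact pairing: the multiplier current is covariantly conserved -/

/-- `𝔰𝔲(2)` is closed under `A − Z`: the difference of two skew-adjoint traceless matrices is skew-adjoint and traceless. [folklore] -/
theorem sub_gaugeDir_mem_su2 {A Z : Matrix (Fin 2) (Fin 2) ℂ} (hA : A ∈ skewAdjoint (Matrix (Fin 2) (Fin 2) ℂ)) (hAt : A.trace = 0)
    (hZ : Z ∈ skewAdjoint (Matrix (Fin 2) (Fin 2) ℂ)) (hZt : Z.trace = 0) :
    A - Z ∈ skewAdjoint (Matrix (Fin 2) (Fin 2) ℂ) ∧ (A - Z).trace = 0 :=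
  ⟨(skewAdjoint (Matrix (Fin 2) (Fin 2) ℂ)).sub_mem hA hZ, by rw [Matrix.trace_sub, hAt, hZt, sub_zero]⟩

set_option maxHeartbeats 400000 in
/-- ★★ **THE GAUGED EXACT PAIRING — THE MULTIPLIER CURRENT IS COVARIANTLY CONSERVED.**  For an R2-critical `U₀ ∈ (6)(ε₀)` (`10¹⁰L⁶ε₀ ≤ 1`), every recursion family `Q` of the
true one-step linearisations along `U₀`'s tower, every `𝔰𝔲(2)`-valued bond field `A` and every `𝔰𝔲(2)`-valued COARSE site field `μ` on the level-`(K−n)` lattice: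
`|Lin_{U₀}(A)| ≤ 2ε₀·L^{−(K−n)}·Σ_c‖(Q (K−n) A)(c) − (μ(c₋) − Ū₀^{(K−n)}(c)·μ(c₊)·Ū₀^{(K−n)}(c)*)‖`.  Proof: extend `μ` to the fine lattice by `λ := μ ∘ iterBlockOf (K−n)`
(`λ ∘ embIter (K−n) = μ`, ✓`Node00.iterBlockOf_embIter_eq`); `Lin_{U₀}(A) = Lin_{U₀}(A − Z^λ)` (✓`lin_sub_gaugeDir_eq`); the exact pairing ✓`abs_lin_le_sum_norm_trueLinIter` at the
`𝔰𝔲(2)`-valued `A − Z^λ`; `Q (K−n) (A − Z^λ) = Q (K−n) A − P_{Ū₀^{(K−n)}}(λ ∘ embIter (K−n))` (✓`trueLinIter_sub`, ✓`trueLinIter_pureGauge` under the (0.4) guards of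
✓`tower_loop_rows_of_regPr`). [cite: Balaban1985Variational, (141)-(143) p.299; Balaban1985BackgroundPropagators, (3.9)-(3.11) p.392; Balaban1985Averaging, (11) p.19, (124) p.36] -/
theorem abs_lin_le_sum_norm_trueLinIter_sub_coarseGauge (F : T3Family) {n K : ℕ} (hnK : n ≤ K)
    {V : GaugeField (F.P n) 0 (Matrix.specialUnitaryGroup (Fin 2) ℂ)} {U₀ : GaugeField (F.P K) 0 (Matrix.specialUnitaryGroup (Fin 2) ℂ)}
    (hcrit : IsCritR2 F n K hnK V U₀) {ε₀ : ℝ} (hε₀ : 0 < ε₀) (hε : 10 ^ 10 * (F.L : ℝ) ^ 6 * ε₀ ≤ 1) (hU₀reg : RegPr F n K ε₀ U₀)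
    (Q : (k : ℕ) → (PBond (F.P K) 0 → Matrix (Fin 2) (Fin 2) ℂ) → PBond (F.P K) k → Matrix (Fin 2) (Fin 2) ℂ) (hQ0 : ∀ Y, Q 0 Y = Y)
    (hQs : ∀ (k : ℕ) (Y : PBond (F.P K) 0 → Matrix (Fin 2) (Fin 2) ℂ) (c : PBond (F.P K) (k + 1)), Q (k + 1) Y c
      = fderiv ℂ (eml : (Idx (F.P K) → Matrix (Fin 2) (Fin 2) ℂ) → Matrix (Fin 2) (Fin 2) ℂ)
            (fun i => ((loopHol (Averaging.iter (fun i => blockAvg (P := F.P K) (j := i) (expMeanLogSU (n := Fin 2))) k U₀) c i :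
              Matrix.specialUnitaryGroup (Fin 2) ℂ) : Matrix (Fin 2) (Fin 2) ℂ))
            (fun i => covWalkSum (Averaging.iter (fun i => blockAvg (P := F.P K) (j := i) (expMeanLogSU (n := Fin 2))) k U₀) (Q k Y)
                (walk (emb c.src) (loopWord (F.P K).L c.dir (off i.1) i.2.1 i.2.2))
              * ((loopHol (Averaging.iter (fun i => blockAvg (P := F.P K) (j := i) (expMeanLogSU (n := Fin 2))) k U₀) c i :
                Matrix.specialUnitaryGroup (Fin 2) ℂ) : Matrix (Fin 2) (Fin 2) ℂ))
            * star ((corr (expMeanLogSU (n := Fin 2)) (Averaging.iter (fun i => blockAvg (P := F.P K) (j := i) (expMeanLogSU (n := Fin 2))) k U₀) c :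
                Matrix.specialUnitaryGroup (Fin 2) ℂ) : Matrix (Fin 2) (Fin 2) ℂ)
          + ((corr (expMeanLogSU (n := Fin 2)) (Averaging.iter (fun i => blockAvg (P := F.P K) (j := i) (expMeanLogSU (n := Fin 2))) k U₀) c :
                Matrix.specialUnitaryGroup (Fin 2) ℂ) : Matrix (Fin 2) (Fin 2) ℂ)
            * covWalkSum (Averaging.iter (fun i => blockAvg (P := F.P K) (j := i) (expMeanLogSU (n := Fin 2))) k U₀) (Q k Y)
                (walk (emb c.src) (List.replicate (F.P K).L (c.dir, true)))
            * star ((corr (expMeanLogSU (n := Fin 2)) (Averaging.iter (fun i => blockAvg (P := F.P K) (j := i) (expMeanLogSU (n := Fin 2))) k U₀) c :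
                Matrix.specialUnitaryGroup (Fin 2) ℂ) : Matrix (Fin 2) (Fin 2) ℂ))
    (A : PBond (F.P K) 0 → Matrix (Fin 2) (Fin 2) ℂ) (hA : ∀ b, A b ∈ skewAdjoint (Matrix (Fin 2) (Fin 2) ℂ)) (htr : ∀ b, (A b).trace = 0)
    (μ : Site (F.P K) (K - n) → Matrix (Fin 2) (Fin 2) ℂ) (hμ : ∀ y, μ y ∈ skewAdjoint (Matrix (Fin 2) (Fin 2) ℂ)) (hμt : ∀ y, (μ y).trace = 0) :
    |∑ p : Plaq (F.P K) 0, (1 / 2) * ((((((GaugeField.plaqHol U₀ p : Matrix.specialUnitaryGroup (Fin 2) ℂ) : Matrix (Fin 2) (Fin 2) ℂ)) - 1)ᴴ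
          * ((A ⟨p.src, p.μ⟩
              + (U₀ ⟨p.src, p.μ⟩ : Matrix (Fin 2) (Fin 2) ℂ) * A ⟨p.src.shift p.μ, p.ν⟩ * star (U₀ ⟨p.src, p.μ⟩ : Matrix (Fin 2) (Fin 2) ℂ)
              - ((U₀ ⟨p.src, p.μ⟩ * U₀ ⟨p.src.shift p.μ, p.ν⟩ * (U₀ ⟨p.src.shift p.ν, p.μ⟩)⁻¹ : Matrix.specialUnitaryGroup (Fin 2) ℂ) : Matrix (Fin 2) (Fin 2) ℂ)
                  * A ⟨p.src.shift p.ν, p.μ⟩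
                  * star ((U₀ ⟨p.src, p.μ⟩ * U₀ ⟨p.src.shift p.μ, p.ν⟩ * (U₀ ⟨p.src.shift p.ν, p.μ⟩)⁻¹ : Matrix.specialUnitaryGroup (Fin 2) ℂ) : Matrix (Fin 2) (Fin 2) ℂ)
              - ((GaugeField.plaqHol U₀ p : Matrix.specialUnitaryGroup (Fin 2) ℂ) : Matrix (Fin 2) (Fin 2) ℂ) * A ⟨p.src, p.ν⟩
                  * star ((GaugeField.plaqHol U₀ p : Matrix.specialUnitaryGroup (Fin 2) ℂ) : Matrix (Fin 2) (Fin 2) ℂ))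
            * ((GaugeField.plaqHol U₀ p : Matrix.specialUnitaryGroup (Fin 2) ℂ) : Matrix (Fin 2) (Fin 2) ℂ))).trace).re|
      ≤ 2 * ε₀ * ((F.L : ℝ) ^ (K - n))⁻¹ * ∑ c : PBond (F.P K) (K - n), ‖Q (K - n) A c
          - (μ c.src
              - ((Averaging.iter (fun i => blockAvg (P := F.P K) (j := i) (expMeanLogSU (n := Fin 2))) (K - n) U₀ c : Matrix.specialUnitaryGroup (Fin 2) ℂ) :
                  Matrix (Fin 2) (Fin 2) ℂ) * μ c.tgt
                * star ((Averaging.iter (fun i => blockAvg (P := F.P K) (j := i) (expMeanLogSU (n := Fin 2))) (K - n) U₀ c : Matrix.specialUnitaryGroup (Fin 2) ℂ) :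
                  Matrix (Fin 2) (Fin 2) ℂ))‖ := by
  -- the fine extension `λ := μ ∘ iterBlockOf (K−n)` of the coarse gauge function and its gauge direction `Z^λ`
  set lam : Site (F.P K) 0 → Matrix (Fin 2) (Fin 2) ℂ := fun x => μ (iterBlockOf (K - n) x) with hlam
  have hlam_emb : ∀ y : Site (F.P K) (K - n), lam (embIter (K - n) y) = μ y := fun y => by
    rw [hlam]
    exact congrArg μ (iterBlockOf_embIter_eq (show K - n ≤ (F.P K).m + (F.P K).K from by show K - n ≤ F.m + K; omega) y)
  have hlam_su : ∀ x, lam x ∈ skewAdjoint (Matrix (Fin 2) (Fin 2) ℂ) := fun x => hμ _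
  have hlam_tr : ∀ x, (lam x).trace = 0 := fun x => hμt _
  -- the gauged direction `A − Z^λ` is `𝔰𝔲(2)`-valued
  have hAZ : ∀ b : PBond (F.P K) 0, (fun b : PBond (F.P K) 0 => A b - (lam b.src - (U₀ b : Matrix (Fin 2) (Fin 2) ℂ) * lam (b.src.shift b.dir) * star (U₀ b : Matrix (Fin 2) (Fin 2) ℂ))) b
      ∈ skewAdjoint (Matrix (Fin 2) (Fin 2) ℂ) := fun b =>
    (sub_gaugeDir_mem_su2 (hA b) (htr b) (gaugeDir_mem_su2 (hlam_su _) (hlam_tr _) (hlam_su _) (hlam_tr _) (U₀ b)).1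
      (gaugeDir_mem_su2 (hlam_su _) (hlam_tr _) (hlam_su _) (hlam_tr _) (U₀ b)).2).1
  have hAZt : ∀ b : PBond (F.P K) 0, ((fun b : PBond (F.P K) 0 => A b - (lam b.src - (U₀ b : Matrix (Fin 2) (Fin 2) ℂ) * lam (b.src.shift b.dir) * star (U₀ b : Matrix (Fin 2) (Fin 2) ℂ))) b).trace = 0 :=
    fun b => (sub_gaugeDir_mem_su2 (hA b) (htr b) (gaugeDir_mem_su2 (hlam_su _) (hlam_tr _) (hlam_su _) (hlam_tr _) (U₀ b)).1
      (gaugeDir_mem_su2 (hlam_su _) (hlam_tr _) (hlam_su _) (hlam_tr _) (U₀ b)).2).2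
  -- gauge invariance of the first variation and the exact pairing along `A − Z^λ`
  have hinv := lin_sub_gaugeDir_eq U₀ A lam
  have hEL := abs_lin_le_sum_norm_trueLinIter F hnK hcrit hε₀ hε hU₀reg Q hQ0 hQs
    (fun b : PBond (F.P K) 0 => A b - (lam b.src - (U₀ b : Matrix (Fin 2) (Fin 2) ℂ) * lam (b.src.shift b.dir) * star (U₀ b : Matrix (Fin 2) (Fin 2) ℂ))) hAZ hAZt
  beta_reduce at hinv hEL
  rw [hinv] at hEL
  refine hEL.trans (le_of_eq ?_)
  congr 1
  refine Finset.sum_congr rfl fun c _ => ?_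
  -- `Q (K−n) (A − Z^λ) = Q (K−n) A − P_{Ū₀^{(K−n)}}(λ ∘ embIter (K−n))`
  obtain ⟨hα, _, haN⟩ := tower_loop_rows_of_regPr F hε₀ hε hU₀reg (K := K) (n := n)
  have hg : ∀ j < K - n, ∀ (c : PBond (F.P K) (j + 1)) (i : Idx (F.P K)),
      dist1 (loopHol (Averaging.iter (fun i => blockAvg (P := F.P K) (j := i) (expMeanLogSU (n := Fin 2))) j U₀) c i) < deltaSU (Fin 2) :=
    fun j hj c i => (hα j hj c i).trans_lt (haN j hj)
  have hsub := trueLinIter_sub U₀ Q hQ0 hQs (K - n) A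
    (fun b : PBond (F.P K) 0 => lam b.src - ((U₀ b : Matrix.specialUnitaryGroup (Fin 2) ℂ) : Matrix (Fin 2) (Fin 2) ℂ) * lam b.tgt *
      star ((U₀ b : Matrix.specialUnitaryGroup (Fin 2) ℂ) : Matrix (Fin 2) (Fin 2) ℂ)) c
  have hpg := trueLinIter_pureGauge U₀ Q hQ0 hQs lam (K - n) hg c
  have hfun : (fun b : PBond (F.P K) 0 => A b - (lam b.src - (U₀ b : Matrix (Fin 2) (Fin 2) ℂ) * lam (b.src.shift b.dir) * star (U₀ b : Matrix (Fin 2) (Fin 2) ℂ)))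
      = A - (fun b : PBond (F.P K) 0 => lam b.src - ((U₀ b : Matrix.specialUnitaryGroup (Fin 2) ℂ) : Matrix (Fin 2) (Fin 2) ℂ) * lam b.tgt *
            star ((U₀ b : Matrix.specialUnitaryGroup (Fin 2) ℂ) : Matrix (Fin 2) (Fin 2) ℂ)) := by
    funext b; rfl
  rw [hfun, hsub, hpg, hlam_emb, hlam_emb]

/-! ## §2 One member, one datum -/

set_option maxHeartbeats 400000 in
/-- ★★ **E′ AT A DATUM FROM CHART_W ∧ HESS_W′ ∧ THE JOINT REMAINDER ROW MODULO COARSE GAUGE.**  `W ∈ (6)(e) ∩ 𝔅_k(V)` R2-critical, `10¹⁰L⁶e ≤ 1`; `Q` any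
recursion family of the true one-step linearisations along `W`'s tower (displayed, zero content).  Every competitor `W′ ∈ (6)(e) ∩ 𝔅_k(V)` comes with a
Hermitian-traceless `D`, `‖D(b)‖ ≤ s`, `A(W′) = A(e^{iD}W)`, the slice gap `κ·Σ‖D‖² ≤ Σ_p‖ℒ_p(D)‖²` and the JOINT row MODULO COARSE GAUGE: an `𝔰𝔲(2)`-valued site field
`μ` on the level-`(K−n)` lattice with `Σ_c‖(Q (K−n) (iD))(c) − (μ(c₋) − W̄^{(K−n)}(c)μ(c₊)W̄^{(K−n)}(c)*)‖ ≤ C₁·(L^{K−n})⁻¹·Σ‖D‖² + C₂·L^{K−n}·Σ_p‖ℒ_p(D)‖²`.  If `4s ≤ 1`,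
`2eC₂ ≤ ⅛` and `15552s² + 216·regThreshold(e) + 2eC₁·(L^{K−n})⁻² ≤ κ∕8`, then `W` minimises the Wilson action over (6)(e) ∩ 𝔅_k(V).  The first variation is charged by
§1's gauged pairing (rate `2e·(L^{K−n})⁻¹` on the `ℓ¹` norm of `Q (K−n) (iD)` MINUS the coarse pure gauge of `μ`); the action-level step is ★w4's socket
✓`isMinOn_regFibrePr_of_linRows_at` ∘ ✓`linRow_of_QRows` (Taylor at θ = ½ inside).
[cite: Balaban1985Variational, (141)-(143) p.299, (47)-(48) pp.285-286, (116) p.295, (6) p.278; Balaban1985BackgroundPropagators, (3.9)-(3.11) p.392] -/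
theorem isMinOn_regFibrePr_of_gaugedRows_at (F : T3Family) {n K : ℕ} (h : n ≤ K) {e s κ C₁ C₂ : ℝ}
    (V : GaugeField (F.P n) 0 (Matrix.specialUnitaryGroup (Fin 2) ℂ)) {W : GaugeField (F.P K) 0 (Matrix.specialUnitaryGroup (Fin 2) ℂ)}
    (hW : IsCritR2 F n K h V W) (hWe : W ∈ regFibrePr F n K h e V) (he : 10 ^ 10 * (F.L : ℝ) ^ 6 * e ≤ 1)
    (Q : (k : ℕ) → (PBond (F.P K) 0 → Matrix (Fin 2) (Fin 2) ℂ) → PBond (F.P K) k → Matrix (Fin 2) (Fin 2) ℂ) (hQ0 : ∀ Y, Q 0 Y = Y)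
    (hQs : ∀ (k : ℕ) (Y : PBond (F.P K) 0 → Matrix (Fin 2) (Fin 2) ℂ) (c : PBond (F.P K) (k + 1)), Q (k + 1) Y c
      = fderiv ℂ (eml : (Idx (F.P K) → Matrix (Fin 2) (Fin 2) ℂ) → Matrix (Fin 2) (Fin 2) ℂ)
            (fun i => ((loopHol (Averaging.iter (fun i => blockAvg (P := F.P K) (j := i) (expMeanLogSU (n := Fin 2))) k W) c i :
              Matrix.specialUnitaryGroup (Fin 2) ℂ) : Matrix (Fin 2) (Fin 2) ℂ))
            (fun i => covWalkSum (Averaging.iter (fun i => blockAvg (P := F.P K) (j := i) (expMeanLogSU (n := Fin 2))) k W) (Q k Y)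
                (walk (emb c.src) (loopWord (F.P K).L c.dir (off i.1) i.2.1 i.2.2))
              * ((loopHol (Averaging.iter (fun i => blockAvg (P := F.P K) (j := i) (expMeanLogSU (n := Fin 2))) k W) c i :
                Matrix.specialUnitaryGroup (Fin 2) ℂ) : Matrix (Fin 2) (Fin 2) ℂ))
            * star ((corr (expMeanLogSU (n := Fin 2)) (Averaging.iter (fun i => blockAvg (P := F.P K) (j := i) (expMeanLogSU (n := Fin 2))) k W) c :
                Matrix.specialUnitaryGroup (Fin 2) ℂ) : Matrix (Fin 2) (Fin 2) ℂ)
          + ((corr (expMeanLogSU (n := Fin 2)) (Averaging.iter (fun i => blockAvg (P := F.P K) (j := i) (expMeanLogSU (n := Fin 2))) k W) c :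
                Matrix.specialUnitaryGroup (Fin 2) ℂ) : Matrix (Fin 2) (Fin 2) ℂ)
            * covWalkSum (Averaging.iter (fun i => blockAvg (P := F.P K) (j := i) (expMeanLogSU (n := Fin 2))) k W) (Q k Y)
                (walk (emb c.src) (List.replicate (F.P K).L (c.dir, true)))
            * star ((corr (expMeanLogSU (n := Fin 2)) (Averaging.iter (fun i => blockAvg (P := F.P K) (j := i) (expMeanLogSU (n := Fin 2))) k W) c :
                Matrix.specialUnitaryGroup (Fin 2) ℂ) : Matrix (Fin 2) (Fin 2) ℂ))
    (hrows : ∀ W' : GaugeField (F.P K) 0 (Matrix.specialUnitaryGroup (Fin 2) ℂ), W' ∈ regFibrePr F n K h e V →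
        ∃ (D : PBond (F.P K) 0 → Matrix (Fin 2) (Fin 2) ℂ),
          (∀ b : PBond (F.P K) 0, (D b).IsHermitian ∧ Matrix.trace (D b) = 0) ∧ (∀ b : PBond (F.P K) 0, ‖D b‖ ≤ s) ∧
          wilsonAction4 W' = wilsonAction4 (emb15 W (expHermField D)) ∧
          κ * ∑ b : PBond (F.P K) 0, ‖D b‖ ^ 2
            ≤ ∑ p : Plaq (F.P K) 0, ‖((Complex.I • D ⟨p.src, p.μ⟩) + ((W ⟨p.src, p.μ⟩ : Matrix (Fin 2) (Fin 2) ℂ) * (Complex.I • D ⟨p.src.shift p.μ, p.ν⟩) * star (W ⟨p.src, p.μ⟩ : Matrix (Fin 2) (Fin 2) ℂ))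
            - (((W ⟨p.src, p.μ⟩ * W ⟨p.src.shift p.μ, p.ν⟩ * (W ⟨p.src.shift p.ν, p.μ⟩)⁻¹ : Matrix.specialUnitaryGroup (Fin 2) ℂ) : Matrix (Fin 2) (Fin 2) ℂ) * (Complex.I • D ⟨p.src.shift p.ν, p.μ⟩) * star ((W ⟨p.src, p.μ⟩ * W ⟨p.src.shift p.μ, p.ν⟩ * (W ⟨p.src.shift p.ν, p.μ⟩)⁻¹ : Matrix.specialUnitaryGroup (Fin 2) ℂ) : Matrix (Fin 2) (Fin 2) ℂ))
            - (((GaugeField.plaqHol W p : Matrix.specialUnitaryGroup (Fin 2) ℂ) : Matrix (Fin 2) (Fin 2) ℂ) * (Complex.I • D ⟨p.src, p.ν⟩) * star ((GaugeField.plaqHol W p : Matrix.specialUnitaryGroup (Fin 2) ℂ) : Matrix (Fin 2) (Fin 2) ℂ)))‖ ^ 2 ∧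
          ∃ μ : Site (F.P K) (K - n) → Matrix (Fin 2) (Fin 2) ℂ, (∀ y, μ y ∈ skewAdjoint (Matrix (Fin 2) (Fin 2) ℂ) ∧ (μ y).trace = 0) ∧
          ∑ c : PBond (F.P K) (K - n), ‖Q (K - n) (fun b => Complex.I • D b) c
              - (μ c.src
                - ((Averaging.iter (fun i => blockAvg (P := F.P K) (j := i) (expMeanLogSU (n := Fin 2))) (K - n) W c : Matrix.specialUnitaryGroup (Fin 2) ℂ) :
                    Matrix (Fin 2) (Fin 2) ℂ) * μ c.tgt
                  * star ((Averaging.iter (fun i => blockAvg (P := F.P K) (j := i) (expMeanLogSU (n := Fin 2))) (K - n) W c : Matrix.specialUnitaryGroup (Fin 2) ℂ) :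
                    Matrix (Fin 2) (Fin 2) ℂ))‖
            ≤ C₁ * ((F.L : ℝ) ^ (K - n))⁻¹ * ∑ b : PBond (F.P K) 0, ‖D b‖ ^ 2
              + C₂ * (F.L : ℝ) ^ (K - n) * ∑ p : Plaq (F.P K) 0, ‖((Complex.I • D ⟨p.src, p.μ⟩) + ((W ⟨p.src, p.μ⟩ : Matrix (Fin 2) (Fin 2) ℂ) * (Complex.I • D ⟨p.src.shift p.μ, p.ν⟩) * star (W ⟨p.src, p.μ⟩ : Matrix (Fin 2) (Fin 2) ℂ))
            - (((W ⟨p.src, p.μ⟩ * W ⟨p.src.shift p.μ, p.ν⟩ * (W ⟨p.src.shift p.ν, p.μ⟩)⁻¹ : Matrix.specialUnitaryGroup (Fin 2) ℂ) : Matrix (Fin 2) (Fin 2) ℂ) * (Complex.I • D ⟨p.src.shift p.ν, p.μ⟩) * star ((W ⟨p.src, p.μ⟩ * W ⟨p.src.shift p.μ, p.ν⟩ * (W ⟨p.src.shift p.ν, p.μ⟩)⁻¹ : Matrix.specialUnitaryGroup (Fin 2) ℂ) : Matrix (Fin 2) (Fin 2) ℂ))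
            - (((GaugeField.plaqHol W p : Matrix.specialUnitaryGroup (Fin 2) ℂ) : Matrix (Fin 2) (Fin 2) ℂ) * (Complex.I • D ⟨p.src, p.ν⟩) * star ((GaugeField.plaqHol W p : Matrix.specialUnitaryGroup (Fin 2) ℂ) : Matrix (Fin 2) (Fin 2) ℂ)))‖ ^ 2)
    (hs4 : 4 * s ≤ 1) (hθ : 2 * e * C₂ ≤ 1 / 8)
    (hsmall : 15552 * s ^ 2 + 216 * regThreshold F n K e + 2 * e * C₁ * (((F.L : ℝ) ^ (K - n)) ^ 2)⁻¹ ≤ κ / 8) :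
    IsMinOn (fun W' : GaugeField (F.P K) 0 (Matrix.specialUnitaryGroup (Fin 2) ℂ) => wilsonAction4 W') (regFibrePr F n K h e V) W := by
  have hreg : RegPr F n K e W := ((mem_regFibrePr_iff F).mp hWe).2
  have he0 : 0 < e := pos_of_regPr F hreg
  refine isMinOn_regFibrePr_of_linRows_at F h V hWe fun W' hW' => ?_
  obtain ⟨D, hDh, hDs, hA, hq, μ, hμ, hJ⟩ := hrows W' hW'
  -- THE GAUGED MULTIPLIER BOUND along `A := iD` (§1), then ★w4's `Q`-currency bookkeeping `linRow_of_QRows` with `R :=` the gauged sum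
  have hsk : ∀ b : PBond (F.P K) 0, (fun b => Complex.I • D b) b ∈ skewAdjoint (Matrix (Fin 2) (Fin 2) ℂ) := fun b => I_smul_mem_skewAdjoint (hDh b).1
  have htr : ∀ b : PBond (F.P K) 0, ((fun b => Complex.I • D b) b).trace = 0 := fun b => trace_I_smul_eq_zero (hDh b).2
  have hEL := abs_lin_le_sum_norm_trueLinIter_sub_coarseGauge F h hW he0 he hreg Q hQ0 hQs (fun b => Complex.I • D b) hsk htr
    μ (fun y => (hμ y).1) (fun y => (hμ y).2)
  beta_reduce at hEL
  exact ⟨D, s, hDh, hDs, hs4, hA, linRow_of_QRows F he0.le W D hEL hJ hq hθ (by linarith [hsmall])⟩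

/-! ## §3 The E′ text of record with `L`-only constants, JOINT row modulo coarse gauge -/

set_option maxHeartbeats 400000 in
/-- ★★★ **ROW E′ ([Balaban1985Variational] (141)–(142) in print's regime) FROM CHART_W ∧ HESS_W′ ∧ THE JOINT REMAINDER ROW MODULO COARSE GAUGE, IN THEIR NATURAL
SCALINGS.**  For every `L > 1` constants `e₆ > 0` with `10¹⁰L⁶e₆ ≤ 1`, `0 ≤ s₀` with `4s₀ ≤ 1`, `C₁, C₂ ≥ 0` with `16e₆C₂ ≤ 1`, `κ₀` with
`15552s₀² + 216e₆ + 2e₆C₁ ≤ κ₀∕8`, such that at every member `(F, n, K)`, every radius `0 < e ≤ e₆`, every datum `V`, every R2-critical `W ∈ (6)(e) ∩ 𝔅_k(V)` and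
every recursion family `Q` of the true one-step linearisations along `W`'s tower, the rows CHART_W (radius `s₀·L^{−(K−n)}`), HESS_W′ (`κ₀·L^{−2(K−n)}`) and JOINT MOD
COARSE GAUGE (`∃ μ` `𝔰𝔲(2)`-valued on the `(K−n)`-sites, `Σ_c‖(Q (K−n) (iD))(c) − (μ(c₋) − W̄(c)μ(c₊)W̄(c)*)‖ ≤ C₁·L^{−(K−n)}·Σ‖D‖² + C₂·L^{K−n}·Σ_p‖ℒ_p(D)‖²`) hold for every
competitor.  CONCLUSION = the E′ text verbatim (`e₅ := e₆`, `a₁'' := 1`), as in ✓`Prop7LocMinOfMultiplierRows.stub_PV3E_of_multiplierRows`.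
[cite: Balaban1985Variational, (141)-(143) p.299, Prop. 7 p.299, (4)-(7) p.278, (14) p.280, (47)-(48) pp.285-286, (80) p.290, (116) p.295; Balaban1985BackgroundPropagators, (3.9)-(3.11) p.392] -/
theorem stub_PV3E_of_gaugedRows
    (hrowsU : ∀ (L : ℕ), 1 < L → ∃ e₆ s₀ C₁ C₂ κ₀ : ℝ, 0 < e₆ ∧ 10 ^ 10 * (L : ℝ) ^ 6 * e₆ ≤ 1 ∧ 0 ≤ s₀ ∧ 4 * s₀ ≤ 1 ∧ 0 ≤ C₁ ∧ 0 ≤ C₂ ∧ 16 * e₆ * C₂ ≤ 1 ∧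
      15552 * s₀ ^ 2 + 216 * e₆ + 2 * e₆ * C₁ ≤ κ₀ / 8 ∧
      ∀ (F : T3Family), F.L = L → ∀ (n K : ℕ) (hnK : n < K) (e : ℝ) (V : GaugeField (F.P n) 0 (Matrix.specialUnitaryGroup (Fin 2) ℂ))
        (W : GaugeField (F.P K) 0 (Matrix.specialUnitaryGroup (Fin 2) ℂ)),
        0 < e → e ≤ e₆ → W ∈ regFibrePr F n K hnK.le e V → IsCritR2 F n K hnK.le V W →
        ∀ (Q : (k : ℕ) → (PBond (F.P K) 0 → Matrix (Fin 2) (Fin 2) ℂ) → PBond (F.P K) k → Matrix (Fin 2) (Fin 2) ℂ), (∀ Y, Q 0 Y = Y) →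
        (∀ (k : ℕ) (Y : PBond (F.P K) 0 → Matrix (Fin 2) (Fin 2) ℂ) (c : PBond (F.P K) (k + 1)), Q (k + 1) Y c
          = fderiv ℂ (eml : (Idx (F.P K) → Matrix (Fin 2) (Fin 2) ℂ) → Matrix (Fin 2) (Fin 2) ℂ)
              (fun i => ((loopHol (Averaging.iter (fun i => blockAvg (P := F.P K) (j := i) (expMeanLogSU (n := Fin 2))) k W) c i :
                Matrix.specialUnitaryGroup (Fin 2) ℂ) : Matrix (Fin 2) (Fin 2) ℂ))
              (fun i => covWalkSum (Averaging.iter (fun i => blockAvg (P := F.P K) (j := i) (expMeanLogSU (n := Fin 2))) k W) (Q k Y)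
                  (walk (emb c.src) (loopWord (F.P K).L c.dir (off i.1) i.2.1 i.2.2))
                * ((loopHol (Averaging.iter (fun i => blockAvg (P := F.P K) (j := i) (expMeanLogSU (n := Fin 2))) k W) c i :
                  Matrix.specialUnitaryGroup (Fin 2) ℂ) : Matrix (Fin 2) (Fin 2) ℂ))
              * star ((corr (expMeanLogSU (n := Fin 2)) (Averaging.iter (fun i => blockAvg (P := F.P K) (j := i) (expMeanLogSU (n := Fin 2))) k W) c :
                  Matrix.specialUnitaryGroup (Fin 2) ℂ) : Matrix (Fin 2) (Fin 2) ℂ)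
            + ((corr (expMeanLogSU (n := Fin 2)) (Averaging.iter (fun i => blockAvg (P := F.P K) (j := i) (expMeanLogSU (n := Fin 2))) k W) c :
                  Matrix.specialUnitaryGroup (Fin 2) ℂ) : Matrix (Fin 2) (Fin 2) ℂ)
              * covWalkSum (Averaging.iter (fun i => blockAvg (P := F.P K) (j := i) (expMeanLogSU (n := Fin 2))) k W) (Q k Y)
                  (walk (emb c.src) (List.replicate (F.P K).L (c.dir, true)))
              * star ((corr (expMeanLogSU (n := Fin 2)) (Averaging.iter (fun i => blockAvg (P := F.P K) (j := i) (expMeanLogSU (n := Fin 2))) k W) c :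
                  Matrix.specialUnitaryGroup (Fin 2) ℂ) : Matrix (Fin 2) (Fin 2) ℂ)) →
        ∀ W' : GaugeField (F.P K) 0 (Matrix.specialUnitaryGroup (Fin 2) ℂ), W' ∈ regFibrePr F n K hnK.le e V →
          ∃ (D : PBond (F.P K) 0 → Matrix (Fin 2) (Fin 2) ℂ),
            (∀ b : PBond (F.P K) 0, (D b).IsHermitian ∧ Matrix.trace (D b) = 0) ∧ (∀ b : PBond (F.P K) 0, ‖D b‖ ≤ s₀ * ((F.L : ℝ) ^ (K - n))⁻¹) ∧
            wilsonAction4 W' = wilsonAction4 (emb15 W (expHermField D)) ∧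
            κ₀ * (((F.L : ℝ) ^ (K - n)) ^ 2)⁻¹ * ∑ b : PBond (F.P K) 0, ‖D b‖ ^ 2
              ≤ ∑ p : Plaq (F.P K) 0, ‖((Complex.I • D ⟨p.src, p.μ⟩) + ((W ⟨p.src, p.μ⟩ : Matrix (Fin 2) (Fin 2) ℂ) * (Complex.I • D ⟨p.src.shift p.μ, p.ν⟩) * star (W ⟨p.src, p.μ⟩ : Matrix (Fin 2) (Fin 2) ℂ))
            - (((W ⟨p.src, p.μ⟩ * W ⟨p.src.shift p.μ, p.ν⟩ * (W ⟨p.src.shift p.ν, p.μ⟩)⁻¹ : Matrix.specialUnitaryGroup (Fin 2) ℂ) : Matrix (Fin 2) (Fin 2) ℂ) * (Complex.I • D ⟨p.src.shift p.ν, p.μ⟩) * star ((W ⟨p.src, p.μ⟩ * W ⟨p.src.shift p.μ, p.ν⟩ * (W ⟨p.src.shift p.ν, p.μ⟩)⁻¹ : Matrix.specialUnitaryGroup (Fin 2) ℂ) : Matrix (Fin 2) (Fin 2) ℂ))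
            - (((GaugeField.plaqHol W p : Matrix.specialUnitaryGroup (Fin 2) ℂ) : Matrix (Fin 2) (Fin 2) ℂ) * (Complex.I • D ⟨p.src, p.ν⟩) * star ((GaugeField.plaqHol W p : Matrix.specialUnitaryGroup (Fin 2) ℂ) : Matrix (Fin 2) (Fin 2) ℂ)))‖ ^ 2 ∧
            ∃ μ : Site (F.P K) (K - n) → Matrix (Fin 2) (Fin 2) ℂ, (∀ y, μ y ∈ skewAdjoint (Matrix (Fin 2) (Fin 2) ℂ) ∧ (μ y).trace = 0) ∧
            ∑ c : PBond (F.P K) (K - n), ‖Q (K - n) (fun b => Complex.I • D b) c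
                - (μ c.src
                  - ((Averaging.iter (fun i => blockAvg (P := F.P K) (j := i) (expMeanLogSU (n := Fin 2))) (K - n) W c : Matrix.specialUnitaryGroup (Fin 2) ℂ) :
                      Matrix (Fin 2) (Fin 2) ℂ) * μ c.tgt
                    * star ((Averaging.iter (fun i => blockAvg (P := F.P K) (j := i) (expMeanLogSU (n := Fin 2))) (K - n) W c : Matrix.specialUnitaryGroup (Fin 2) ℂ) :
                      Matrix (Fin 2) (Fin 2) ℂ))‖
              ≤ C₁ * ((F.L : ℝ) ^ (K - n))⁻¹ * ∑ b : PBond (F.P K) 0, ‖D b‖ ^ 2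
                + C₂ * (F.L : ℝ) ^ (K - n) * ∑ p : Plaq (F.P K) 0, ‖((Complex.I • D ⟨p.src, p.μ⟩) + ((W ⟨p.src, p.μ⟩ : Matrix (Fin 2) (Fin 2) ℂ) * (Complex.I • D ⟨p.src.shift p.μ, p.ν⟩) * star (W ⟨p.src, p.μ⟩ : Matrix (Fin 2) (Fin 2) ℂ))
            - (((W ⟨p.src, p.μ⟩ * W ⟨p.src.shift p.μ, p.ν⟩ * (W ⟨p.src.shift p.ν, p.μ⟩)⁻¹ : Matrix.specialUnitaryGroup (Fin 2) ℂ) : Matrix (Fin 2) (Fin 2) ℂ) * (Complex.I • D ⟨p.src.shift p.ν, p.μ⟩) * star ((W ⟨p.src, p.μ⟩ * W ⟨p.src.shift p.μ, p.ν⟩ * (W ⟨p.src.shift p.ν, p.μ⟩)⁻¹ : Matrix.specialUnitaryGroup (Fin 2) ℂ) : Matrix (Fin 2) (Fin 2) ℂ))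
            - (((GaugeField.plaqHol W p : Matrix.specialUnitaryGroup (Fin 2) ℂ) : Matrix (Fin 2) (Fin 2) ℂ) * (Complex.I • D ⟨p.src, p.ν⟩) * star ((GaugeField.plaqHol W p : Matrix.specialUnitaryGroup (Fin 2) ℂ) : Matrix (Fin 2) (Fin 2) ℂ)))‖ ^ 2) :
    ∀ (L : ℕ), 1 < L → ∀ (B₃ : ℝ), 4 < B₃ →
    ∃ e₅ a₁'' : ℝ, 0 < e₅ ∧ 0 < a₁'' ∧ ∀ (i : Idx L) (e ε₁ : ℝ) (V : GaugeField (i.1.1.P i.1.2.1) 0 (Matrix.specialUnitaryGroup (Fin 2) ℂ))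
      (U₀ W : GaugeField (i.1.1.P i.1.2.2) 0 (Matrix.specialUnitaryGroup (Fin 2) ℂ)),
      0 < ε₁ → ε₁ ≤ a₁'' → PlaqSmall ε₁ V → (L : ℝ) ^ 3 * B₃ * ε₁ ≤ e → e ≤ e₅ →
      RegPr i.1.1 i.1.2.1 i.1.2.2 ((L : ℝ) ^ 3 * B₃ * ε₁) U₀ → CloseAvg i.1.1 i.1.2.1 i.1.2.2 i.2.2.le ((L : ℝ) ^ 3 * ε₁) V U₀ →
      W ∈ regFibrePr i.1.1 i.1.2.1 i.1.2.2 i.2.2.le e V → IsCritR2 i.1.1 i.1.2.1 i.1.2.2 i.2.2.le V W →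
        IsMinOn (fun W' : GaugeField (i.1.1.P i.1.2.2) 0 (Matrix.specialUnitaryGroup (Fin 2) ℂ) => wilsonAction4 W')
          (regFibrePr i.1.1 i.1.2.1 i.1.2.2 i.2.2.le e V) W := by
  intro L hL B₃ hB₃
  obtain ⟨e₆, s₀, C₁, C₂, κ₀, he₆, he₆L, hs₀, hs₀4, hC₁, hC₂, hC₂e, hsmall, H⟩ := hrowsU L hL
  refine ⟨e₆, 1, he₆, one_pos, ?_⟩
  intro i e ε₁ V U₀ W hε₁ _hε₁a _hV hlo hhi _hRU₀ _hclose hW hWcrit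
  obtain ⟨⟨F, n, K⟩, hF, hnK⟩ := i
  have hL0 : (0 : ℝ) < (L : ℝ) := by exact_mod_cast (show 0 < L by omega)
  have he0 : 0 < e := lt_of_lt_of_le (by positivity) hlo
  have hL1 : (1 : ℝ) ≤ (F.L : ℝ) := by have := F.hL.2; exact_mod_cast (by omega : 1 ≤ F.L)
  have hℓ1 : (1 : ℝ) ≤ (F.L : ℝ) ^ (K - n) := one_le_pow₀ hL1
  have hℓ0 : (0 : ℝ) < (F.L : ℝ) ^ (K - n) := by linarith
  -- the scaled radius is `≤ s₀`, hence `4s ≤ 1`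
  have hs4 : 4 * (s₀ * ((F.L : ℝ) ^ (K - n))⁻¹) ≤ 1 := by
    have hi : ((F.L : ℝ) ^ (K - n))⁻¹ ≤ 1 := inv_le_one_of_one_le₀ hℓ1
    nlinarith [mul_le_mul_of_nonneg_left hi hs₀]
  -- the window `10¹⁰L⁶e ≤ 1` at this member and `2eC₂ ≤ ⅛`
  have heL : 10 ^ 10 * (F.L : ℝ) ^ 6 * e ≤ 1 := by
    have hFL : (F.L : ℝ) = (L : ℝ) := by exact_mod_cast hF
    rw [hFL]
    have : 10 ^ 10 * (L : ℝ) ^ 6 * e ≤ 10 ^ 10 * (L : ℝ) ^ 6 * e₆ := mul_le_mul_of_nonneg_left hhi (by positivity)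
    exact this.trans he₆L
  have hθ : 2 * e * C₂ ≤ 1 / 8 := by nlinarith [mul_le_mul_of_nonneg_right hhi hC₂]
  -- a recursion family at `W` (zero content) and the rows at it
  obtain ⟨Q, hQ0, hQs⟩ := exists_trueLinIter_family (N := 2) W
  exact isMinOn_regFibrePr_of_gaugedRows_at F hnK.le V hWcrit hW heL Q hQ0 hQs
    (H F hF n K hnK e V W he0 hhi hW hWcrit Q hQ0 hQs) hs4 hθ (scaled_smallness_mult F n K hhi hC₁ hsmall)

end Summit.QuantumFields.YangMills.Theorems.Prop7LocMinOfGaugedRows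

end
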